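import Mathlib
import Summits.NavierStokesRegularity.NavierStokesRegularity.Theorems.BarrierStepRungThreeBarrierSoundnessRegion
import HarnessLib

/-!
# `BarrierSoundness` (route `BarrierStepRungThree`), tools III-b: rates along a pseudo-flow for the
  certificate format with PER-COORDINATE window caps `Φ i j` (variant of tools III)

Helper lemmas for the repaired form K2″ (`barrierSoundness₃`) of item stmt-NavierStokesRegularity-23421:
the same two lemmas as `clock_rate_of_clauses` / `lower_rate_of_clauses` of tools III, for a
certificate whose window caps and properness bounds are indexed by mode AND shell (`Φ, Mw : Fin 4 →
Fin n → ℝ`) — the carrier and trigger modes of a cascade table live at very different scales, and the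
top window shells must be allowed tiny caps (they feed the one-directional tail recursion), so a
single cap per shell / a single properness bound `M` is needlessly restrictive for the ∃-side.

HONEST FRAMING: MODEL lattice bookkeeping only (Tao 2016 §4); nothing here is a statement about the
Navier–Stokes equations; the route's rung leaf (`TaoLadderRungThree.Target`, TL-M3) is not the summit
Statement.
-/

noncomputable section

-- the sub-problem namespace `Summit.NavierStokesRegularity.NavierStokesRegularity` repeats the summit name by design (D-0017)
set_option linter.dupNamespace false

namespace Summit.NavierStokesRegularity.NavierStokesRegularity.Theorems

namespace BarrierSoundness

open Set MeasureTheory intervalIntegral Filter Topology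
open Literature.Analysis.FluidPDE Literature.Analysis.FluidPDE.TaoCascade GappedFrontRobust

variable {τ η : ℝ} {α : Fin 4 → Fin 4 → Fin 4 → ℤ × ℤ × ℤ → ℝ}
  {S₀ F₀ B₀ : Fin 4 → ℤ → ℝ} {S F : Fin 4 → ℤ → ℝ → ℝ} {n : ℕ} {kLo : ℤ}
  {v g : (Fin 4 → Fin n → ℝ) → ℝ} {r q ρ : ℤ → ℝ} {Φ : Fin 4 → Fin n → ℝ}
  {win : (Fin 4 → ℤ → ℝ) → (Fin 4 → Fin n → ℝ)} {vf : (Fin 4 → ℤ → ℝ) → (Fin 4 → ℤ → ℝ)}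

/-- **Clock rate from ROBUST DECREASE.** Along an `(η, η)`-pseudo-flow, at a time `u` where the state
is a REGION state of the certificate and `g > 0`, the clock observable `v ∘ win` decreases at rate
`≥ γ`: the window components of `S' = quadTerm + (S' - quadTerm)` form the certified vector field plus a
disturbance with `|d_{i,j}| ≤ η 4^{kLo+j} √(F_{i,kLo+j}) ≤ η 4^{kLo+j} √Φ_j` by (4.8).
[cite: Tao2016AveragedNS, §4 Lemma 4.1 (4.8); doi:10.1137/050645178 §3.4 (robust decrease)] -/
theorem clock_rate_of_clauses₃ {γ : ℝ} (hflow : PseudoFlowOn τ 1 α η η S₀ F₀ B₀ S F) (hη : 0 ≤ η)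
    {u : ℝ} (hu : u ∈ Icc 0 τ)
    (hwin : ∀ (S : Fin 4 → ℤ → ℝ) (i : Fin 4) (j : Fin n), win S i j = S i (kLo + (j : ℕ)))
    (hvf : ∀ (S : Fin 4 → ℤ → ℝ) (i : Fin 4) (k : ℤ), vf S i k = Literature.Analysis.FluidPDE.TaoCascade.quadTerm 1 α (fun i' k' (_ : ℝ) => S i' k') i k 0)
    (hdec : (∀ (S F : Fin 4 → ℤ → ℝ) (d : Fin 4 → Fin n → ℝ), (v (win S) ≤ 0 ∧ (∀ i k, S i k ^ 2 ≤ 2 * F i k) ∧ (∀ i k, 0 ≤ F i k) ∧ (∀ i k, (k < kLo ∨ kLo + n ≤ k) → F i k ≤ q k ^ 2 / 2) ∧ (∀ (i : Fin 4) (j : Fin n), F i (kLo + (j : ℕ)) ≤ Φ i j)) → 0 < g (win S) → (∀ (i : Fin 4) (j : Fin n), |d i j| ≤ η * (1 + 1 : ℝ) ^ ((2 : ℝ) * ((kLo + (j : ℕ) : ℤ) : ℝ)) * Real.sqrt (Φ i j)) → (fderiv ℝ v (win S)) (fun i j => vf S i (kLo + (j : ℕ)) + d i j) ≤ -γ))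
    (hreg : (v (win (fun i k => S i k u)) ≤ 0 ∧ (∀ i k, (fun i k => S i k u) i k ^ 2 ≤ 2 * (fun i k => F i k u) i k) ∧ (∀ i k, 0 ≤ (fun i k => F i k u) i k) ∧ (∀ i k, (k < kLo ∨ kLo + n ≤ k) → (fun i k => F i k u) i k ≤ q k ^ 2 / 2) ∧ (∀ (i : Fin 4) (j : Fin n), (fun i k => F i k u) i (kLo + (j : ℕ)) ≤ Φ i j)))
    (hgpos : 0 < g (win (fun i k => S i k u))) :
    (fderiv ℝ v (fun i (j : Fin n) => S i (kLo + (j : ℕ)) u))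
      (fun i (j : Fin n) => derivWithin (S i (kLo + (j : ℕ))) (Icc 0 τ) u) ≤ -γ := by
  -- the disturbance: window defect of the equation of motion
  set d : Fin 4 → Fin n → ℝ := fun i j =>
    derivWithin (S i (kLo + (j : ℕ))) (Icc 0 τ) u - vf (fun i k => S i k u) i (kLo + (j : ℕ)) with hd
  have hΦcap : ∀ (i : Fin 4) (j : Fin n), F i (kLo + (j : ℕ)) u ≤ Φ i j := hreg.2.2.2.2
  have hdbox : ∀ (i : Fin 4) (j : Fin n),
      |d i j| ≤ η * (1 + 1 : ℝ) ^ ((2 : ℝ) * ((kLo + (j : ℕ) : ℤ) : ℝ)) * Real.sqrt (Φ i j) := by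
    intro i j
    have hm := hflow.motion i (kLo + (j : ℕ)) u hu
    simp only [Int.cast_add, Int.cast_natCast] at hm
    have hd' : d i j = derivWithin (S i (kLo + (j : ℕ))) (Icc 0 τ) u -
        quadTerm 1 α S i (kLo + (j : ℕ)) u := by
      simp only [hd, vf_slice_eq_quadTerm hvf]
    rw [hd']
    refine hm.trans ?_
    have hpow : 0 ≤ η * (1 + 1 : ℝ) ^ ((2 : ℝ) * ((kLo : ℝ) + ((j : ℕ) : ℝ))) := by positivity
    have h2 := mul_le_mul_of_nonneg_left (Real.sqrt_le_sqrt (hΦcap i j)) hpow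
    push_cast at h2 ⊢
    exact h2
  have h := hdec (fun i k => S i k u) (fun i k => F i k u) d hreg hgpos hdbox
  have hw : win (fun i k => S i k u) = fun i (j : Fin n) => S i (kLo + (j : ℕ)) u :=
    funext fun i => funext fun j => hwin _ i j
  have hsum : (fun i (j : Fin n) => vf (fun i k => S i k u) i (kLo + (j : ℕ)) + d i j) =
      fun i (j : Fin n) => derivWithin (S i (kLo + (j : ℕ))) (Icc 0 τ) u := by
    funext i j
    simp only [hd]
    ring
  rw [hw, hsum] at h
  exact h

/-- **Energy rate below the window from TAIL RATE.** Along an `(η, η)`-pseudo-flow, at a time `u`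
where the state is a REGION state, every mode `(i, k)` below the window (`k < kLo`) obeys
`F'_{i,k} ≤ ρ_k √(2 F_{i,k})`: (4.9) has no defect term, the certificate bounds `quadTerm·S ≤ ρ|S|`, and
`|S| ≤ √(2F)` by (4.10). [cite: Tao2016AveragedNS, §4 Lemma 4.1 (4.9)–(4.10)] -/
theorem lower_rate_of_clauses₃ (hflow : PseudoFlowOn τ 1 α η η S₀ F₀ B₀ S F) {u : ℝ}
    (hu : u ∈ Icc 0 τ)
    (hvf : ∀ (S : Fin 4 → ℤ → ℝ) (i : Fin 4) (k : ℤ), vf S i k = Literature.Analysis.FluidPDE.TaoCascade.quadTerm 1 α (fun i' k' (_ : ℝ) => S i' k') i k 0)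
    (htail : (∀ (S F : Fin 4 → ℤ → ℝ), (v (win S) ≤ 0 ∧ (∀ i k, S i k ^ 2 ≤ 2 * F i k) ∧ (∀ i k, 0 ≤ F i k) ∧ (∀ i k, (k < kLo ∨ kLo + n ≤ k) → F i k ≤ q k ^ 2 / 2) ∧ (∀ (i : Fin 4) (j : Fin n), F i (kLo + (j : ℕ)) ≤ Φ i j)) → ∀ (i : Fin 4) (k : ℤ), k < kLo → vf S i k * S i k ≤ ρ k * |S i k|))
    (hreg : (v (win (fun i k => S i k u)) ≤ 0 ∧ (∀ i k, (fun i k => S i k u) i k ^ 2 ≤ 2 * (fun i k => F i k u) i k) ∧ (∀ i k, 0 ≤ (fun i k => F i k u) i k) ∧ (∀ i k, (k < kLo ∨ kLo + n ≤ k) → (fun i k => F i k u) i k ≤ q k ^ 2 / 2) ∧ (∀ (i : Fin 4) (j : Fin n), (fun i k => F i k u) i (kLo + (j : ℕ)) ≤ Φ i j)))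
    {i : Fin 4} {k : ℤ} (hk : k < kLo) (hρ : 0 ≤ ρ k) :
    derivWithin (F i k) (Icc 0 τ) u ≤ ρ k * Real.sqrt (2 * F i k u) := by
  have h1 := hflow.energy i k u hu
  have h2 := htail (fun i k => S i k u) (fun i k => F i k u) hreg i k hk
  rw [vf_slice_eq_quadTerm hvf] at h2
  have h3 : |S i k u| ≤ Real.sqrt (2 * F i k u) :=
    Real.abs_le_sqrt (by linarith [hflow.defect_lower i k u hu])
  calc derivWithin (F i k) (Icc 0 τ) u ≤ quadTerm 1 α S i k u * S i k u := h1
    _ ≤ ρ k * |S i k u| := h2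
    _ ≤ ρ k * Real.sqrt (2 * F i k u) := mul_le_mul_of_nonneg_left h3 hρ

end BarrierSoundness

end Summit.NavierStokesRegularity.NavierStokesRegularity.Theorems

end
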